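import Summits.QuantumFields.YangMills.Theorems.UnitScaleTiltProp7LatticeBoxFriedrichs
import Summits.QuantumFields.YangMills.Theorems.UnitScaleTiltProp7CovariantBlockPoincare
import HarnessLib

/-!
# Route `UnitScaleTilt`, crux K1 «MinimiserStabilityRegPr» (stmt-QuantumFields-19200) — route-R E′ (A′), (N06) row `hN06`, LANE II «DIVERGENCE RECOVERY AT CURVED W»
# (★★OWNER g29 RULING №23 (c): §4 box bricks → px4; ★p1 g19 SKELETON-LANE2-DIVREC §4 (B1′) `boxFriedrichs_curved`), part 1∕2 of (B1′):
# **THE BOX FRIEDRICHS INEQUALITY FOR MATRIX-VALUED ONE-FORMS AND FOR COVARIANT DIFFERENCES IN A SMALL-BOND GAUGE** —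
# `Σ‖g‖² ≤ N(2R+1)²·(3∕2·CURL^V_inside + 2·DIV^V_box) + 20dN(2R+1)²θ²·Σ‖g‖²` when every box bond of the background is `θ`-close to `1`

Cell `ym3-torus`, width seat `ym3-torus-px4` (gen 7).  THEOREMS ONLY (0 `def`, 0 `sorry`); `--supports stmt-QuantumFields-19200 --as helper`, count-neutral; consumer-independent.  YM₃ on T³
is a ladder rung (R3), not d = 4, not infinite volume, not the Clay problem; nothing here claims [Balaban1985BackgroundPropagators] Thm 3.3 ∕ 3.11, `hN06`, (REC), E′, EX, H, the crux or the gap.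

LETTERS.  `Zd d` (= lit `B7Prop1Explicit.Site d = Fin d → ℤ`), `box z R`, `unitVec` (lit ✓`B4Eq19LatticeOperators`); one-forms `g : Zd d → Fin d → M_N(ℂ)` living on the edges of `Q_R(z)`
(`g y μ = 0` unless `y, y + e_μ ∈ Q_R(z)`); background `V : Zd d → Fin d → M_N(ℂ)ˣ`, unitary (`U1`), transport `R(u)X = uXu⁻¹` = lit ✓`B7Eq78Linearization.conjR`; norms = the L2-operator norm
(scoped `Matrix.Norms.L2Operator`).  COVARIANT curl on the plaquette `(y; μ, ν)`: `g y μ + R(V y μ) g(y+e_μ) ν − R(V y ν) g(y+e_ν) μ − g y ν`; COVARIANT graph divergence at `y`: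
`Σ_μ (R(V(y−e_μ) μ)⁻¹ g(y−e_μ) μ − g y μ)` ([Balaban1985BackgroundPropagators] (3.8)–(3.9) p.392 at unit spacing).

WHAT IS PROVED (ns `…Theorems.Prop7LatticeBoxFriedrichsCov`):
* §1 ★`sum_sq_le_box_friedrichs_matrix` — part 2∕2's ✓`Prop7LatticeBoxFriedrichs.sum_sq_le_box_friedrichs` for `M_N(ℂ)`-valued one-forms (componentwise over the `2N²` real parts, factor `N`
  through ✓`opNorm_sq_le_sum_re_sq_add_im_sq` ∕ ✓`sum_re_sq_add_im_sq_le_mul_opNorm_sq`, the ✓`block227_matrix` pattern): `Σ_{Q_R}Σ_μ‖g y μ‖² ≤ N(2R+1)²(½·CURL_inside + DIV_box)` (flat).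
* §2 pointwise defects in a small-bond gauge (`‖V y μ − 1‖ ≤ θ` on box bonds): `norm_conjR_sub_self_le`, `norm_conjR_inv_sub_self_le`, `norm_flatCurl_sq_le`, `norm_flatDiv_sq_le` (`‖flat‖² ≤ 3‖cov‖² + 12θ²(…)`, `≤ 2‖cov‖² + 8dθ²(…)`);
  shifted-sum bookkeeping `sum_box_shift_le` (§3).
* §3 ★★★`sum_sq_le_box_friedrichs_cov` — THE COVARIANT BOX FRIEDRICHS INEQUALITY IN A SMALL-BOND GAUGE: for `0 ≤ R`, `V` unitary with `‖V y μ − 1‖ ≤ θ` on the box bonds, `g` living on the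
  box edges:  `Σ_{Q_R}Σ_μ‖g y μ‖² ≤ N(2R+1)²·((3∕2)·Σ_{Q_R}Σ_μΣ_ν [y+e_μ+e_ν ∈ Q_R]·‖cov-curl‖² + 2·Σ_{Q_R}‖cov-div‖²) + 20·d·N·(2R+1)²·θ²·Σ_{Q_R}Σ_μ‖g y μ‖²`.  Part 2∕2 (`…Curved`) removes the
  gauge by lit ✓`B8Lemma1NonAbelian.axial_bond_bound_sharp` (`θ = 2dR·α` from the plaquette bound `α`), giving the skeleton's (B1′) shape `CF·M²·(CURL + DIV) + CF′·(M²α)²·Σ‖g‖²`.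
HONEST SCOPE.  Flat lattice calculus + unitary-conjugation bookkeeping; nothing of print asserted; rung R3, not Clay; YM gap NOT proved.

References: T. Bałaban, CMP **95** (1984) 17–40 [Balaban1984PropagatorsI] ((1.21) p.21, Prop. 1.1 p.33); CMP **99** (1985) 389–434 [Balaban1985BackgroundPropagators] ((3.8)–(3.10) p.392);
CMP **98** (1985) 17–51 [Balaban1985Averaging] (pp.24–25, (56) p.27).
-/

set_option autoImplicit false

noncomputable section

open scoped BigOperators Matrix.Norms.L2Operator
open Finset

namespace Summit.QuantumFields.YangMills.Theorems.Prop7LatticeBoxFriedrichsCov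

open Literature.MathematicalPhysics.QuantumFieldTheory.Balaban1983to89
open Literature.MathematicalPhysics.QuantumFieldTheory.Balaban1983to89.B4Eq19LatticeOperators
open B7Prop1Explicit (U1)
open B7Eq78Linearization (conjR conjR_apply conjR_sub conjR_add)
open B8Ineq132 (norm_conjR conjR_conjR one_conjR)
open Summit.QuantumFields.YangMills.Theorems.Prop7CovariantCoercivity (norm_conjR_sub_conjR_le norm_inv_sub_inv_le opNorm_sq_le_sum_re_sq_add_im_sq
  sum_re_sq_add_im_sq_le_mul_opNorm_sq sum_sum_sum_comm)
open Summit.QuantumFields.YangMills.Theorems.Prop7LatticeBoxFriedrichs (sum_sq_le_box_friedrichs sum_le_sum_of_support)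

variable {d N : ℕ}

/-! ## §1 The flat box Friedrichs inequality for matrix-valued one-forms -/

section Flat

/-- Bookkeeping: a double component sum commutes with a double lattice sum. [folklore] -/
theorem sum_comm4 {ι κ : Type*} (s : Finset ι) (t : Finset κ) (T : ι → κ → Fin N → Fin N → ℝ) :
    ∑ j : Fin N, ∑ k : Fin N, ∑ x ∈ s, ∑ m ∈ t, T x m j k = ∑ x ∈ s, ∑ m ∈ t, ∑ j : Fin N, ∑ k : Fin N, T x m j k := by
  rw [sum_sum_sum_comm]
  exact Finset.sum_congr rfl fun x _ => sum_sum_sum_comm t (fun m j k => T x m j k)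

/-- Bookkeeping: a double component sum commutes with a triple lattice sum. [folklore] -/
theorem sum_comm5 {ι κ κ' : Type*} (s : Finset ι) (t : Finset κ) (t' : Finset κ') (T : ι → κ → κ' → Fin N → Fin N → ℝ) :
    ∑ j : Fin N, ∑ k : Fin N, ∑ x ∈ s, ∑ m ∈ t, ∑ m' ∈ t', T x m m' j k = ∑ x ∈ s, ∑ m ∈ t, ∑ m' ∈ t', ∑ j : Fin N, ∑ k : Fin N, T x m m' j k := by
  rw [sum_comm4]
  exact Finset.sum_congr rfl fun x _ => Finset.sum_congr rfl fun m _ => sum_sum_sum_comm t' (fun m' j k => T x m m' j k)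

/-- One real component of the flat box Friedrichs inequality: for an additive `c : M_N(ℂ) → ℝ` (a real coordinate), ✓`sum_sq_le_box_friedrichs` for `c ∘ g`. [cite: Balaban1984PropagatorsI, (1.21) p.21] -/
theorem component_box_friedrichs {z : Zd d} {R : ℤ} (hR : 0 ≤ R) (g : Zd d → Fin d → Matrix (Fin N) (Fin N) ℂ)
    (hg : ∀ (y : Zd d) (μ : Fin d), (y ∉ box z R ∨ y + unitVec μ ∉ box z R) → g y μ = 0)
    (c : Matrix (Fin N) (Fin N) ℂ →+ ℝ) :
    ∑ y ∈ box z R, ∑ μ, c (g y μ) ^ 2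
      ≤ (2 * (R : ℝ) + 1) ^ 2 *
        ((1 / 2) * ∑ y ∈ box z R, ∑ μ, ∑ ν,
            (if y + unitVec μ + unitVec ν ∈ box z R then c (g y μ + g (y + unitVec μ) ν - g (y + unitVec ν) μ - g y ν) ^ 2 else 0)
          + ∑ y ∈ box z R, c (∑ μ, (g (y - unitVec μ) μ - g y μ)) ^ 2) := by
  have h := sum_sq_le_box_friedrichs (g := fun y μ => c (g y μ)) (z := z) hR (fun y μ hyμ => by simp only [hg y μ hyμ, map_zero])
  have e1 : ∀ (y : Zd d) (μ ν : Fin d),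
      fdiff μ (fun x => c (g x ν)) y - fdiff ν (fun x => c (g x μ)) y = c (g y μ + g (y + unitVec μ) ν - g (y + unitVec ν) μ - g y ν) := by
    intro y μ ν
    simp only [fdiff, map_add, map_sub]; ring
  have e2 : ∀ y : Zd d, dvg (fun y μ => c (g y μ)) y = c (∑ μ, (g (y - unitVec μ) μ - g y μ)) := by
    intro y
    rw [dvg_apply, map_sum]
    exact Finset.sum_congr rfl fun μ _ => (map_sub c _ _).symm
  simp only [e1, e2] at h
  exact h

/-- The real-part and imaginary-part coordinates of a matrix entry, as additive maps. [folklore] -/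
theorem exists_coord_addMonoidHom (j k : Fin N) :
    (∃ c : Matrix (Fin N) (Fin N) ℂ →+ ℝ, ∀ A, c A = (A j k).re) ∧ (∃ c : Matrix (Fin N) (Fin N) ℂ →+ ℝ, ∀ A, c A = (A j k).im) := by
  refine ⟨⟨⟨⟨fun A => (A j k).re, by simp⟩, fun A B => by simp⟩, fun A => rfl⟩, ⟨⟨⟨fun A => (A j k).im, by simp⟩, fun A B => by simp⟩, fun A => rfl⟩⟩

/-- ★ **FLAT BOX FRIEDRICHS FOR `M_N(ℂ)`-VALUED ONE-FORMS** (✓`sum_sq_le_box_friedrichs` on the `2N²` real components, compared with the operator norm):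
for `g` living on the edges of `Q_R(z)`, `Σ_{Q_R}Σ_μ‖g y μ‖² ≤ N(2R+1)²·(½·Σ_{Q_R}Σ_μΣ_ν [y+e_μ+e_ν ∈ Q_R]·‖g y μ + g(y+e_μ) ν − g(y+e_ν) μ − g y ν‖² + Σ_{Q_R}‖Σ_μ (g(y−e_μ) μ − g y μ)‖²)`.
[cite: Balaban1984PropagatorsI, (1.21) p.21, Prop. 1.1 p.33] -/
theorem sum_sq_le_box_friedrichs_matrix {z : Zd d} {R : ℤ} (hR : 0 ≤ R) (g : Zd d → Fin d → Matrix (Fin N) (Fin N) ℂ)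
    (hg : ∀ (y : Zd d) (μ : Fin d), (y ∉ box z R ∨ y + unitVec μ ∉ box z R) → g y μ = 0) :
    ∑ y ∈ box z R, ∑ μ, ‖g y μ‖ ^ 2
      ≤ N * (2 * (R : ℝ) + 1) ^ 2 *
        ((1 / 2) * ∑ y ∈ box z R, ∑ μ, ∑ ν,
            (if y + unitVec μ + unitVec ν ∈ box z R then ‖g y μ + g (y + unitVec μ) ν - g (y + unitVec ν) μ - g y ν‖ ^ 2 else 0)
          + ∑ y ∈ box z R, ‖∑ μ, (g (y - unitVec μ) μ - g y μ)‖ ^ 2) := by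
  classical
  set CU : Zd d → Fin d → Fin d → Matrix (Fin N) (Fin N) ℂ := fun y μ ν => g y μ + g (y + unitVec μ) ν - g (y + unitVec ν) μ - g y ν with hCU
  set DV : Zd d → Matrix (Fin N) (Fin N) ℂ := fun y => ∑ μ, (g (y - unitVec μ) μ - g y μ) with hDV
  set χ : Zd d → Fin d → Fin d → ℝ := fun y μ ν => if y + unitVec μ + unitVec ν ∈ box z R then 1 else 0 with hχ
  have hχ0 : ∀ y μ ν, 0 ≤ χ y μ ν := fun y μ ν => by simp only [hχ]; split_ifs <;> norm_num
  -- rewrite the `if`s as indicator multiplications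
  have hite : ∀ (y : Zd d) (μ ν : Fin d) (t : ℝ), (if y + unitVec μ + unitVec ν ∈ box z R then t else 0) = χ y μ ν * t := by
    intro y μ ν t; simp only [hχ]; split_ifs <;> simp
  -- (i) the component inequalities, `2N²` of them
  have hjk : ∀ j k : Fin N,
      ∑ y ∈ box z R, ∑ μ, (((g y μ) j k).re ^ 2 + ((g y μ) j k).im ^ 2)
        ≤ (2 * (R : ℝ) + 1) ^ 2 *
          ((1 / 2) * ∑ y ∈ box z R, ∑ μ, ∑ ν, χ y μ ν * (((CU y μ ν) j k).re ^ 2 + ((CU y μ ν) j k).im ^ 2)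
            + ∑ y ∈ box z R, (((DV y) j k).re ^ 2 + ((DV y) j k).im ^ 2)) := by
    intro j k
    obtain ⟨⟨cr, hcr⟩, ⟨ci, hci⟩⟩ := exists_coord_addMonoidHom (N := N) j k
    have h1 := component_box_friedrichs hR g hg cr
    have h2 := component_box_friedrichs hR g hg ci
    -- rewrite both in the `χ`∕`CU`∕`DV` letters
    have e1 : ∀ (c : Matrix (Fin N) (Fin N) ℂ →+ ℝ), ∑ y ∈ box z R, ∑ μ, ∑ ν,
        (if y + unitVec μ + unitVec ν ∈ box z R then c (g y μ + g (y + unitVec μ) ν - g (y + unitVec ν) μ - g y ν) ^ 2 else 0)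
        = ∑ y ∈ box z R, ∑ μ, ∑ ν, χ y μ ν * c (CU y μ ν) ^ 2 := by
      intro c
      refine Finset.sum_congr rfl fun y _ => Finset.sum_congr rfl fun μ _ => Finset.sum_congr rfl fun ν _ => ?_
      rw [hite]
    have e2 : ∀ (c : Matrix (Fin N) (Fin N) ℂ →+ ℝ), ∑ y ∈ box z R, c (∑ μ, (g (y - unitVec μ) μ - g y μ)) ^ 2 = ∑ y ∈ box z R, c (DV y) ^ 2 :=
      fun c => rfl
    rw [e1, e2] at h1 h2
    simp only [hcr, hci] at h1 h2
    have e3 : ∀ (y : Zd d) (μ ν : Fin d), χ y μ ν * (((CU y μ ν) j k).re ^ 2 + ((CU y μ ν) j k).im ^ 2)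
        = χ y μ ν * ((CU y μ ν) j k).re ^ 2 + χ y μ ν * ((CU y μ ν) j k).im ^ 2 := fun y μ ν => by ring
    simp only [e3, Finset.sum_add_distrib, mul_add]
    linarith
  -- (ii) sum over the components
  have hsum := Finset.sum_le_sum fun j (_ : j ∈ (Finset.univ : Finset (Fin N))) =>
    Finset.sum_le_sum fun k (_ : k ∈ (Finset.univ : Finset (Fin N))) => hjk j k
  have eL : ∑ j : Fin N, ∑ k : Fin N, ∑ y ∈ box z R, ∑ μ, (((g y μ) j k).re ^ 2 + ((g y μ) j k).im ^ 2)
      = ∑ y ∈ box z R, ∑ μ, ∑ j : Fin N, ∑ k : Fin N, (((g y μ) j k).re ^ 2 + ((g y μ) j k).im ^ 2) :=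
    sum_comm4 _ _ (fun y μ j k => ((g y μ) j k).re ^ 2 + ((g y μ) j k).im ^ 2)
  have eR : ∑ j : Fin N, ∑ k : Fin N, ((2 * (R : ℝ) + 1) ^ 2 *
          ((1 / 2) * ∑ y ∈ box z R, ∑ μ, ∑ ν, χ y μ ν * (((CU y μ ν) j k).re ^ 2 + ((CU y μ ν) j k).im ^ 2)
            + ∑ y ∈ box z R, (((DV y) j k).re ^ 2 + ((DV y) j k).im ^ 2)))
      = (2 * (R : ℝ) + 1) ^ 2 *
          ((1 / 2) * ∑ y ∈ box z R, ∑ μ, ∑ ν, χ y μ ν * ∑ j : Fin N, ∑ k : Fin N, (((CU y μ ν) j k).re ^ 2 + ((CU y μ ν) j k).im ^ 2)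
            + ∑ y ∈ box z R, ∑ j : Fin N, ∑ k : Fin N, (((DV y) j k).re ^ 2 + ((DV y) j k).im ^ 2)) := by
    have hX : ∑ j : Fin N, ∑ k : Fin N, ∑ y ∈ box z R, ∑ μ, ∑ ν, χ y μ ν * (((CU y μ ν) j k).re ^ 2 + ((CU y μ ν) j k).im ^ 2)
        = ∑ y ∈ box z R, ∑ μ, ∑ ν, χ y μ ν * ∑ j : Fin N, ∑ k : Fin N, (((CU y μ ν) j k).re ^ 2 + ((CU y μ ν) j k).im ^ 2) := by
      rw [sum_comm5 (box z R) Finset.univ Finset.univ (fun y μ ν j k => χ y μ ν * (((CU y μ ν) j k).re ^ 2 + ((CU y μ ν) j k).im ^ 2))]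
      refine Finset.sum_congr rfl fun y _ => Finset.sum_congr rfl fun μ _ => Finset.sum_congr rfl fun ν _ => ?_
      rw [Finset.mul_sum]
      exact Finset.sum_congr rfl fun j _ => by rw [Finset.mul_sum]
    have hY : ∑ j : Fin N, ∑ k : Fin N, ∑ y ∈ box z R, (((DV y) j k).re ^ 2 + ((DV y) j k).im ^ 2)
        = ∑ y ∈ box z R, ∑ j : Fin N, ∑ k : Fin N, (((DV y) j k).re ^ 2 + ((DV y) j k).im ^ 2) :=
      sum_sum_sum_comm (box z R) (fun y j k => ((DV y) j k).re ^ 2 + ((DV y) j k).im ^ 2)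
    rw [← hX, ← hY]
    simp only [mul_add, Finset.sum_add_distrib, ← Finset.mul_sum]
  rw [eL, eR] at hsum
  -- (iii) compare with the operator norms
  have hLow : ∑ y ∈ box z R, ∑ μ, ‖g y μ‖ ^ 2 ≤ ∑ y ∈ box z R, ∑ μ, ∑ j : Fin N, ∑ k : Fin N, (((g y μ) j k).re ^ 2 + ((g y μ) j k).im ^ 2) :=
    Finset.sum_le_sum fun y _ => Finset.sum_le_sum fun μ _ => opNorm_sq_le_sum_re_sq_add_im_sq (g y μ)
  have hUp1 : ∑ y ∈ box z R, ∑ μ, ∑ ν, χ y μ ν * ∑ j : Fin N, ∑ k : Fin N, (((CU y μ ν) j k).re ^ 2 + ((CU y μ ν) j k).im ^ 2)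
      ≤ ∑ y ∈ box z R, ∑ μ, ∑ ν, χ y μ ν * (N * ‖CU y μ ν‖ ^ 2) :=
    Finset.sum_le_sum fun y _ => Finset.sum_le_sum fun μ _ => Finset.sum_le_sum fun ν _ =>
      mul_le_mul_of_nonneg_left (sum_re_sq_add_im_sq_le_mul_opNorm_sq _) (hχ0 y μ ν)
  have hUp2 : ∑ y ∈ box z R, ∑ j : Fin N, ∑ k : Fin N, (((DV y) j k).re ^ 2 + ((DV y) j k).im ^ 2) ≤ ∑ y ∈ box z R, (N * ‖DV y‖ ^ 2) :=
    Finset.sum_le_sum fun y _ => sum_re_sq_add_im_sq_le_mul_opNorm_sq _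
  -- assemble
  have hM : (0 : ℝ) ≤ (2 * (R : ℝ) + 1) ^ 2 := sq_nonneg _
  have step : ∑ y ∈ box z R, ∑ μ, ‖g y μ‖ ^ 2
      ≤ (2 * (R : ℝ) + 1) ^ 2 * ((1 / 2) * ∑ y ∈ box z R, ∑ μ, ∑ ν, χ y μ ν * (N * ‖CU y μ ν‖ ^ 2) + ∑ y ∈ box z R, (N * ‖DV y‖ ^ 2)) := by
    refine hLow.trans (hsum.trans ?_)
    exact mul_le_mul_of_nonneg_left (by nlinarith [hUp1, hUp2]) hM
  refine step.trans (le_of_eq ?_)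
  simp only [hite, hCU, hDV, ← Finset.mul_sum]
  have : ∀ (y : Zd d) (μ ν : Fin d), χ y μ ν * (N * ‖g y μ + g (y + unitVec μ) ν - g (y + unitVec ν) μ - g y ν‖ ^ 2)
      = N * (χ y μ ν * ‖g y μ + g (y + unitVec μ) ν - g (y + unitVec ν) μ - g y ν‖ ^ 2) := fun y μ ν => by ring
  simp only [this, ← Finset.mul_sum]
  ring

end Flat

/-! ## §2 Pointwise defects of the covariant curl ∕ divergence in a small-bond gauge -/

section Defects

variable [NeZero N]

/-- `‖R(u)X − X‖ ≤ 2‖u − 1‖·‖X‖` for unitary `u`. [cite: Balaban1985Averaging, (56) p.27] -/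
theorem norm_conjR_sub_self_le {u : (Matrix (Fin N) (Fin N) ℂ)ˣ} (hu : u ∈ U1 (Matrix (Fin N) (Fin N) ℂ)) (X : Matrix (Fin N) (Fin N) ℂ) :
    ‖conjR u X - X‖ ≤ 2 * ‖(u : Matrix (Fin N) (Fin N) ℂ) - 1‖ * ‖X‖ := by
  have h := norm_conjR_sub_conjR_le (U1 (Matrix (Fin N) (Fin N) ℂ)).one_mem hu X
  rwa [one_conjR, Units.val_one] at h

/-- `‖R(u)⁻¹X − X‖ ≤ 2‖u − 1‖·‖X‖` for unitary `u` (`‖u⁻¹ − 1‖ ≤ ‖u − 1‖`). [cite: Balaban1985Averaging, (56) p.27] -/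
theorem norm_conjR_inv_sub_self_le {u : (Matrix (Fin N) (Fin N) ℂ)ˣ} (hu : u ∈ U1 (Matrix (Fin N) (Fin N) ℂ)) (X : Matrix (Fin N) (Fin N) ℂ) :
    ‖conjR u⁻¹ X - X‖ ≤ 2 * ‖(u : Matrix (Fin N) (Fin N) ℂ) - 1‖ * ‖X‖ := by
  have h1 := norm_conjR_sub_self_le ((U1 (Matrix (Fin N) (Fin N) ℂ)).inv_mem hu) X
  have h2 := norm_inv_sub_inv_le (U1 (Matrix (Fin N) (Fin N) ℂ)).one_mem hu
  rw [inv_one, Units.val_one] at h2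
  have hX : 0 ≤ ‖X‖ := norm_nonneg X
  nlinarith

omit [NeZero N] in
/-- **FLAT CURL vs COVARIANT CURL, POINTWISE**: if the two transports on the plaquette move their arguments by at most `2θ‖·‖`, then
`‖flat curl‖² ≤ 3‖covariant curl‖² + 12θ²(‖g(y+e_μ) ν‖² + ‖g(y+e_ν) μ‖²)`. [cite: Balaban1985BackgroundPropagators, (3.9) p.392] -/
theorem norm_flatCurl_sq_le {θ : ℝ} (u v : (Matrix (Fin N) (Fin N) ℂ)ˣ) (A B C D : Matrix (Fin N) (Fin N) ℂ)
    (hB : ‖conjR u B - B‖ ≤ 2 * θ * ‖B‖) (hC : ‖conjR v C - C‖ ≤ 2 * θ * ‖C‖) :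
    ‖A + B - C - D‖ ^ 2 ≤ 3 * ‖A + conjR u B - conjR v C - D‖ ^ 2 + 12 * θ ^ 2 * (‖B‖ ^ 2 + ‖C‖ ^ 2) := by
  have hid : A + B - C - D = (A + conjR u B - conjR v C - D) - (conjR u B - B) + (conjR v C - C) := by abel
  have h1 : ‖A + B - C - D‖ ≤ ‖A + conjR u B - conjR v C - D‖ + ‖conjR u B - B‖ + ‖conjR v C - C‖ := by
    rw [hid]
    calc ‖A + conjR u B - conjR v C - D - (conjR u B - B) + (conjR v C - C)‖
        ≤ ‖A + conjR u B - conjR v C - D - (conjR u B - B)‖ + ‖conjR v C - C‖ := norm_add_le _ _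
      _ ≤ ‖A + conjR u B - conjR v C - D‖ + ‖conjR u B - B‖ + ‖conjR v C - C‖ := add_le_add (norm_sub_le _ _) le_rfl
  have h0 : 0 ≤ ‖A + B - C - D‖ := norm_nonneg _
  have h2 : ‖A + B - C - D‖ ^ 2 ≤ (‖A + conjR u B - conjR v C - D‖ + ‖conjR u B - B‖ + ‖conjR v C - C‖) ^ 2 :=
    pow_le_pow_left₀ h0 h1 2
  have h3 : (‖A + conjR u B - conjR v C - D‖ + ‖conjR u B - B‖ + ‖conjR v C - C‖) ^ 2
      ≤ 3 * (‖A + conjR u B - conjR v C - D‖ ^ 2 + ‖conjR u B - B‖ ^ 2 + ‖conjR v C - C‖ ^ 2) := by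
    nlinarith [sq_nonneg (‖A + conjR u B - conjR v C - D‖ - ‖conjR u B - B‖), sq_nonneg (‖conjR u B - B‖ - ‖conjR v C - C‖),
      sq_nonneg (‖A + conjR u B - conjR v C - D‖ - ‖conjR v C - C‖)]
  have h4 : ‖conjR u B - B‖ ^ 2 ≤ (2 * θ * ‖B‖) ^ 2 := pow_le_pow_left₀ (norm_nonneg _) hB 2
  have h5 : ‖conjR v C - C‖ ^ 2 ≤ (2 * θ * ‖C‖) ^ 2 := pow_le_pow_left₀ (norm_nonneg _) hC 2
  nlinarith

omit [NeZero N] in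
/-- **FLAT DIVERGENCE vs COVARIANT DIVERGENCE, POINTWISE**: if every incoming transport moves its argument by at most `2θ‖·‖`, then
`‖Σ_μ (g(y−e_μ) μ − g y μ)‖² ≤ 2‖Σ_μ (R(V(y−e_μ) μ)⁻¹ g(y−e_μ) μ − g y μ)‖² + 8dθ²·Σ_μ ‖g(y−e_μ) μ‖²`. [cite: Balaban1985BackgroundPropagators, (3.8) p.392] -/
theorem norm_flatDiv_sq_le {θ : ℝ} (u : Fin d → (Matrix (Fin N) (Fin N) ℂ)ˣ) (B A : Fin d → Matrix (Fin N) (Fin N) ℂ)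
    (hB : ∀ μ, ‖conjR (u μ)⁻¹ (B μ) - B μ‖ ≤ 2 * θ * ‖B μ‖) :
    ‖∑ μ, (B μ - A μ)‖ ^ 2 ≤ 2 * ‖∑ μ, (conjR (u μ)⁻¹ (B μ) - A μ)‖ ^ 2 + 8 * d * θ ^ 2 * ∑ μ, ‖B μ‖ ^ 2 := by
  have hid : ∑ μ, (B μ - A μ) = ∑ μ, (conjR (u μ)⁻¹ (B μ) - A μ) - ∑ μ, (conjR (u μ)⁻¹ (B μ) - B μ) := by
    rw [← Finset.sum_sub_distrib]; exact Finset.sum_congr rfl fun μ _ => by abel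
  have h1 : ‖∑ μ, (B μ - A μ)‖ ≤ ‖∑ μ, (conjR (u μ)⁻¹ (B μ) - A μ)‖ + ∑ μ, 2 * θ * ‖B μ‖ := by
    rw [hid]
    exact (norm_sub_le _ _).trans (add_le_add le_rfl ((norm_sum_le _ _).trans (Finset.sum_le_sum fun μ _ => hB μ)))
  have hcs : (∑ μ, 2 * θ * ‖B μ‖) ^ 2 ≤ (Finset.univ : Finset (Fin d)).card * ∑ μ, (2 * θ * ‖B μ‖) ^ 2 :=
    sq_sum_le_card_mul_sum_sq
  rw [Finset.card_univ, Fintype.card_fin] at hcs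
  have e : ∑ μ, (2 * θ * ‖B μ‖) ^ 2 = 4 * θ ^ 2 * ∑ μ, ‖B μ‖ ^ 2 := by
    rw [Finset.mul_sum]; exact Finset.sum_congr rfl fun μ _ => by ring
  rw [e] at hcs
  have ha0 : 0 ≤ ‖∑ μ, (B μ - A μ)‖ := norm_nonneg _
  have h2 := pow_le_pow_left₀ ha0 h1 2
  have h3 : (‖∑ μ, (conjR (u μ)⁻¹ (B μ) - A μ)‖ + ∑ μ, 2 * θ * ‖B μ‖) ^ 2
      ≤ 2 * ‖∑ μ, (conjR (u μ)⁻¹ (B μ) - A μ)‖ ^ 2 + 2 * (∑ μ, 2 * θ * ‖B μ‖) ^ 2 := by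
    nlinarith [sq_nonneg (‖∑ μ, (conjR (u μ)⁻¹ (B μ) - A μ)‖ - ∑ μ, 2 * θ * ‖B μ‖)]
  linarith

end Defects

/-! ## §3 The covariant box Friedrichs inequality in a small-bond gauge -/

section Covariant

variable [NeZero N]

/-- Shifted box sums of a nonnegative function supported in the box are bounded by the unshifted sum. [folklore] -/
theorem sum_box_shift_le {z : Zd d} {R : ℤ} {H : Zd d → ℝ} (hH0 : ∀ y, 0 ≤ H y) (hH : ∀ y ∉ box z R, H y = 0) (v : Zd d) :
    ∑ y ∈ box z R, H (y + v) ≤ ∑ y ∈ box z R, H y := by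
  rw [sum_box_add_right H z v R]
  exact sum_le_sum_of_support hH0 hH

/-- ★★★ **THE COVARIANT BOX FRIEDRICHS INEQUALITY IN A SMALL-BOND GAUGE**: `V` unitary with `‖V y μ − 1‖ ≤ θ` on the bonds of `Q_R(z)`, `g` living on the edges of `Q_R(z)`:
`Σ_{Q_R}Σ_μ‖g y μ‖² ≤ N(2R+1)²·((3∕2)·Σ_{Q_R}Σ_μΣ_ν [y+e_μ+e_ν ∈ Q_R]·‖g y μ + R(V y μ)g(y+e_μ) ν − R(V y ν)g(y+e_ν) μ − g y ν‖² + 2·Σ_{Q_R}‖Σ_μ (R(V(y−e_μ) μ)⁻¹ g(y−e_μ) μ − g y μ)‖²)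
 + 20·d·N·(2R+1)²·θ²·Σ_{Q_R}Σ_μ‖g y μ‖²`. [cite: Balaban1984PropagatorsI, (1.21) p.21, Prop. 1.1 p.33; Balaban1985BackgroundPropagators, (3.8)-(3.9) p.392; Balaban1985Averaging, pp.24-25] -/
theorem sum_sq_le_box_friedrichs_cov {z : Zd d} {R : ℤ} (hR : 0 ≤ R) {θ : ℝ}
    (V : Zd d → Fin d → (Matrix (Fin N) (Fin N) ℂ)ˣ) (hV : ∀ y μ, V y μ ∈ U1 (Matrix (Fin N) (Fin N) ℂ))
    (hVθ : ∀ (y : Zd d) (μ : Fin d), y ∈ box z R → y + unitVec μ ∈ box z R → ‖(V y μ : Matrix (Fin N) (Fin N) ℂ) - 1‖ ≤ θ)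
    (g : Zd d → Fin d → Matrix (Fin N) (Fin N) ℂ)
    (hg : ∀ (y : Zd d) (μ : Fin d), (y ∉ box z R ∨ y + unitVec μ ∉ box z R) → g y μ = 0) :
    ∑ y ∈ box z R, ∑ μ, ‖g y μ‖ ^ 2
      ≤ N * (2 * (R : ℝ) + 1) ^ 2 *
          ((3 / 2) * ∑ y ∈ box z R, ∑ μ, ∑ ν,
              (if y + unitVec μ + unitVec ν ∈ box z R then
                ‖g y μ + conjR (V y μ) (g (y + unitVec μ) ν) - conjR (V y ν) (g (y + unitVec ν) μ) - g y ν‖ ^ 2 else 0)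
            + 2 * ∑ y ∈ box z R, ‖∑ μ, (conjR (V (y - unitVec μ) μ)⁻¹ (g (y - unitVec μ) μ) - g y μ)‖ ^ 2)
        + 20 * d * N * (2 * (R : ℝ) + 1) ^ 2 * θ ^ 2 * ∑ y ∈ box z R, ∑ μ, ‖g y μ‖ ^ 2 := by
  have hflat := sum_sq_le_box_friedrichs_matrix hR g hg
  set S : ℝ := ∑ y ∈ box z R, ∑ μ, ‖g y μ‖ ^ 2 with hS
  -- the transport defects on box edges (or on vanishing values)
  have hdef : ∀ (y : Zd d) (μ ν : Fin d), y ∈ box z R →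
      ‖conjR (V y μ) (g (y + unitVec μ) ν) - g (y + unitVec μ) ν‖ ≤ 2 * θ * ‖g (y + unitVec μ) ν‖ := by
    intro y μ ν hy
    by_cases h0 : g (y + unitVec μ) ν = 0
    · simp [h0, conjR_apply]
    · have hin : y + unitVec μ ∈ box z R := by
        by_contra hc; exact h0 (hg _ _ (Or.inl hc))
      calc _ ≤ 2 * ‖(V y μ : Matrix (Fin N) (Fin N) ℂ) - 1‖ * ‖g (y + unitVec μ) ν‖ := norm_conjR_sub_self_le (hV y μ) _
        _ ≤ 2 * θ * ‖g (y + unitVec μ) ν‖ := by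
            have := hVθ y μ hy hin
            have hn : 0 ≤ ‖g (y + unitVec μ) ν‖ := norm_nonneg _
            nlinarith
  have hdefD : ∀ (y : Zd d) (μ : Fin d), y ∈ box z R →
      ‖conjR (V (y - unitVec μ) μ)⁻¹ (g (y - unitVec μ) μ) - g (y - unitVec μ) μ‖ ≤ 2 * θ * ‖g (y - unitVec μ) μ‖ := by
    intro y μ hy
    by_cases h0 : g (y - unitVec μ) μ = 0
    · simp [h0, conjR_apply]
    · have hin : y - unitVec μ ∈ box z R := by
        by_contra hc; exact h0 (hg _ _ (Or.inl hc))
      calc _ ≤ 2 * ‖(V (y - unitVec μ) μ : Matrix (Fin N) (Fin N) ℂ) - 1‖ * ‖g (y - unitVec μ) μ‖ := norm_conjR_inv_sub_self_le (hV _ _) _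
        _ ≤ 2 * θ * ‖g (y - unitVec μ) μ‖ := by
            have := hVθ (y - unitVec μ) μ hin (by rwa [sub_add_cancel])
            have hn : 0 ≤ ‖g (y - unitVec μ) μ‖ := norm_nonneg _
            nlinarith
  -- the curl sum
  have hC : ∑ y ∈ box z R, ∑ μ, ∑ ν,
        (if y + unitVec μ + unitVec ν ∈ box z R then ‖g y μ + g (y + unitVec μ) ν - g (y + unitVec ν) μ - g y ν‖ ^ 2 else 0)
      ≤ 3 * ∑ y ∈ box z R, ∑ μ, ∑ ν,
            (if y + unitVec μ + unitVec ν ∈ box z R then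
              ‖g y μ + conjR (V y μ) (g (y + unitVec μ) ν) - conjR (V y ν) (g (y + unitVec ν) μ) - g y ν‖ ^ 2 else 0)
        + 24 * d * θ ^ 2 * S := by
    -- termwise
    have ht : ∀ y ∈ box z R, ∀ (μ ν : Fin d),
        (if y + unitVec μ + unitVec ν ∈ box z R then ‖g y μ + g (y + unitVec μ) ν - g (y + unitVec ν) μ - g y ν‖ ^ 2 else (0 : ℝ))
          ≤ 3 * (if y + unitVec μ + unitVec ν ∈ box z R then
              ‖g y μ + conjR (V y μ) (g (y + unitVec μ) ν) - conjR (V y ν) (g (y + unitVec ν) μ) - g y ν‖ ^ 2 else 0)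
            + 12 * θ ^ 2 * (‖g (y + unitVec μ) ν‖ ^ 2 + ‖g (y + unitVec ν) μ‖ ^ 2) := by
      intro y hy μ ν
      split_ifs with hin
      · have := norm_flatCurl_sq_le (V y μ) (V y ν) (g y μ) (g (y + unitVec μ) ν) (g (y + unitVec ν) μ) (g y ν) (hdef y μ ν hy) (hdef y ν μ hy)
        linarith
      · positivity
    -- sum and bound the transverse values by `2·d·S`
    have h1 : ∑ y ∈ box z R, ∑ μ, ∑ ν, ‖g (y + unitVec μ) ν‖ ^ 2 ≤ d * S := by
      rw [Finset.sum_comm]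
      calc ∑ μ : Fin d, ∑ y ∈ box z R, ∑ ν, ‖g (y + unitVec μ) ν‖ ^ 2 ≤ ∑ _μ : Fin d, S :=
            Finset.sum_le_sum fun μ _ => sum_box_shift_le (H := fun w => ∑ ν, ‖g w ν‖ ^ 2) (fun w => Finset.sum_nonneg fun ν _ => sq_nonneg _)
              (fun w hw => Finset.sum_eq_zero fun ν _ => by rw [hg w ν (Or.inl hw), norm_zero]; ring) (unitVec μ)
        _ = d * S := by simp
    have h2 : ∑ y ∈ box z R, ∑ μ, ∑ ν, ‖g (y + unitVec ν) μ‖ ^ 2 ≤ d * S := by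
      have : ∑ y ∈ box z R, ∑ μ, ∑ ν, ‖g (y + unitVec ν) μ‖ ^ 2 = ∑ y ∈ box z R, ∑ μ, ∑ ν, ‖g (y + unitVec μ) ν‖ ^ 2 :=
        Finset.sum_congr rfl fun y _ => Finset.sum_comm
      rw [this]; exact h1
    calc _ ≤ ∑ y ∈ box z R, ∑ μ, ∑ ν, (3 * (if y + unitVec μ + unitVec ν ∈ box z R then
              ‖g y μ + conjR (V y μ) (g (y + unitVec μ) ν) - conjR (V y ν) (g (y + unitVec ν) μ) - g y ν‖ ^ 2 else 0)
            + 12 * θ ^ 2 * (‖g (y + unitVec μ) ν‖ ^ 2 + ‖g (y + unitVec ν) μ‖ ^ 2)) :=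
          Finset.sum_le_sum fun y hy => Finset.sum_le_sum fun μ _ => Finset.sum_le_sum fun ν _ => ht y hy μ ν
      _ = 3 * ∑ y ∈ box z R, ∑ μ, ∑ ν, (if y + unitVec μ + unitVec ν ∈ box z R then
              ‖g y μ + conjR (V y μ) (g (y + unitVec μ) ν) - conjR (V y ν) (g (y + unitVec ν) μ) - g y ν‖ ^ 2 else 0)
            + 12 * θ ^ 2 * (∑ y ∈ box z R, ∑ μ, ∑ ν, ‖g (y + unitVec μ) ν‖ ^ 2 + ∑ y ∈ box z R, ∑ μ, ∑ ν, ‖g (y + unitVec ν) μ‖ ^ 2) := by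
          simp only [Finset.sum_add_distrib, Finset.mul_sum, mul_add]
      _ ≤ _ := by nlinarith [h1, h2, sq_nonneg θ]
  -- the divergence sum
  have hD : ∑ y ∈ box z R, ‖∑ μ, (g (y - unitVec μ) μ - g y μ)‖ ^ 2
      ≤ 2 * ∑ y ∈ box z R, ‖∑ μ, (conjR (V (y - unitVec μ) μ)⁻¹ (g (y - unitVec μ) μ) - g y μ)‖ ^ 2 + 8 * d * θ ^ 2 * S := by
    have ht : ∀ y ∈ box z R, ‖∑ μ, (g (y - unitVec μ) μ - g y μ)‖ ^ 2
        ≤ 2 * ‖∑ μ, (conjR (V (y - unitVec μ) μ)⁻¹ (g (y - unitVec μ) μ) - g y μ)‖ ^ 2 + 8 * d * θ ^ 2 * ∑ μ, ‖g (y - unitVec μ) μ‖ ^ 2 :=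
      fun y hy => norm_flatDiv_sq_le (fun μ => V (y - unitVec μ) μ) (fun μ => g (y - unitVec μ) μ) (fun μ => g y μ) (fun μ => hdefD y μ hy)
    have h1 : ∑ y ∈ box z R, ∑ μ, ‖g (y - unitVec μ) μ‖ ^ 2 ≤ S := by
      have eL : ∑ y ∈ box z R, ∑ μ, ‖g (y - unitVec μ) μ‖ ^ 2 = ∑ μ : Fin d, ∑ y ∈ box z R, ‖g (y - unitVec μ) μ‖ ^ 2 := Finset.sum_comm
      have eS : S = ∑ μ : Fin d, ∑ y ∈ box z R, ‖g y μ‖ ^ 2 := by rw [hS, Finset.sum_comm]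
      rw [eL, eS]
      refine Finset.sum_le_sum fun μ _ => ?_
      have := sum_box_shift_le (z := z) (R := R) (H := fun w => ‖g w μ‖ ^ 2) (fun w => sq_nonneg _)
        (fun w hw => by simp only [hg w μ (Or.inl hw), norm_zero]; ring) (-unitVec μ)
      simpa [sub_eq_add_neg] using this
    calc _ ≤ ∑ y ∈ box z R, (2 * ‖∑ μ, (conjR (V (y - unitVec μ) μ)⁻¹ (g (y - unitVec μ) μ) - g y μ)‖ ^ 2 + 8 * d * θ ^ 2 * ∑ μ, ‖g (y - unitVec μ) μ‖ ^ 2) :=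
          Finset.sum_le_sum ht
      _ = 2 * ∑ y ∈ box z R, ‖∑ μ, (conjR (V (y - unitVec μ) μ)⁻¹ (g (y - unitVec μ) μ) - g y μ)‖ ^ 2
            + 8 * d * θ ^ 2 * ∑ y ∈ box z R, ∑ μ, ‖g (y - unitVec μ) μ‖ ^ 2 := by
          rw [Finset.sum_add_distrib, Finset.mul_sum, Finset.mul_sum]
      _ ≤ _ := by
          have : 0 ≤ 8 * (d : ℝ) * θ ^ 2 := by positivity
          nlinarith [h1]
  -- assemble
  have hM : (0 : ℝ) ≤ N * (2 * (R : ℝ) + 1) ^ 2 := by positivity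
  have := mul_le_mul_of_nonneg_left (add_le_add (mul_le_mul_of_nonneg_left hC (by norm_num : (0 : ℝ) ≤ 1 / 2)) hD) hM
  have hS0 : S = ∑ y ∈ box z R, ∑ μ, ‖g y μ‖ ^ 2 := hS
  nlinarith [hflat, this]

end Covariant

end Summit.QuantumFields.YangMills.Theorems.Prop7LatticeBoxFriedrichsCov

end
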